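import Literature.MathematicalPhysics.QuantumFieldTheory.Balaban1983to89.Beta.RemainderDecay190HoloChain
import Literature.MathematicalPhysics.QuantumFieldTheory.Balaban1983to89.Beta.RemainderSeamHolo

/-!
# `Beta.RemainderStepAdapterHolo` — the MINIMAL step-object target through which row D4 consumes the shared crux,
# HOLOMORPHIC (`DifferentiableOn ℂ`) currency, H-LAYER datum (offers O-1 / O-2 of
# `HOME/b2b-balaban-beta-an4/D4-CRUX-SOCKETS.md` v1.3–v1.4.1, row D4 OWNER lineage `b2b-balaban-beta-an4`)

Unit `b2b-balaban-beta-an4` (row D4 OWNER; v2.1 gen 49, v3/v3.1 gen 50 staged under FREEZE (0) as STANDING OFFER #10;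
v3.2 gen 85 = v3.1 `HOME/b2b-balaban-beta-an4/g50/D4StepAdapterHolo.v3.1.staged.lean` sha16 eb2097ae22171b42 with THIS
module docstring's header re-worded for the filing and NOTHING ELSE — every declaration byte-identical to v3.1; FILED on the
INTERFACE REQUEST «INTERFACE REQUEST D4 NODE O: `…RemainderStepAdapterHolo.StepObjectD4 : (d N : ℕ) → [NeZero N] → Type`»
of cell pub-balaban-gaps seat g1-p2, `HOME/CLAIMS.log` [GAPSG1P2-IFR-D4-NODEO] 2026-08-22T20:19:30Z and `HOME/INBOX.md`
block of the same stamp — the FREEZE (0) exception of coordinator ruling e34b3e0c item (0); consumers named there: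
`Summits/QuantumFields/BalabanUV/Gaps/D4ScaleSlice`, the gaps plan's `D4NodeOTarget` §6 (L0), `Beta.RemainderResidue.AtSlope` /
`Beta.RemainderResidueFamily.ObjectsFamily`).  Cell pub-balaban, β-function sub-cell, BINDER row D4.
v3.1 (gen 50; v3.1 = the four `toTorusStep_*` rfl projections made `private` after the gate dry-run's `lint.literature-cited-only`): §3′ `toPolLeavesTFac190H_ofActivities` + §4′ `remainderConst_of_stepLeafLists` take the holomorphy datum ONE
LAYER DOWN — `hH : ∀ n X Z, Z ⊂ X → DifferentiableOn ℂ (v ↦ H_n(Z, emb n X v)) (ball 0 α₂)` on the RESUMMED ACTIVITIES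
(design point M2 of D4-CRUX-SOCKETS §3) — the E-layer leaf `hdiff` being DERIVED by co-owner road P3's seam lemma
`RemainderSeamHolo.hdiff_of_activities` (b2b-balaban-beta-d4-p3 g17: (2.38) + X-truncation + the Kotecký–Preiss
smallness in `CondsL` discharge the zero-freeness hypothesis of `B13LocEAnalytic.differentiableOn_locE_param_of_kp`);
and the capstones drop the redundant `0 < d` (derivable from `μ : Fin d`, owner XREAD C-an4g50-1 INFO-1).

HONEST FRAMING.  Bookkeeping over existing carriers; nothing of Bałaban's is asserted; no estimate is proved; the row's
class is unchanged (typed reduction DONE, instance 0/1, D4 DISCHARGE NO DATE).  NOT BetaPertH, NOT continuum, NOT Clay.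
HONEST DEPENDENCY: continuum YM on T⁴ ⇐ BetaPertH ∧ nine spine estimates (0/9 proved); BetaPertH ⇐ (D1) ∧ (D4) ∧
CAP+tail; G-an2-4 gates asym, D1 and NE2/3/4.

WHAT THIS FILE TYPES.
* §1 `StepObjectD4 d N` — the FOUR fields row D4 actually reads from a one-step object on the torus with N cubes per
  direction: the configuration type `Φ`, the analyticity domains `sp2 X` (= 𝔘ᶜ_{k+1}(X, α₀, α₁) of [II] p. 15), the
  RESUMMED activities `H Z` (= H(Z) of [II] (2.9)/(2.37)), and the restriction property `hsp` ([II] p. 15).  From them: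
  `E := locE H` ((2.13) AS A DEFINITION, Kotecký–Preiss form), `toTorusStep` (the Lemma 1–2 fields D4 never reads are
  filled with inert values — legitimate for D4's socket `PolLeavesTFac190`, which reads only `Φ, sp2, H, Ek1`; NOT an
  inhabitant for Theorem I.3's `Deliverables`), `spRestr`, `repr213` (by construction), and `bound238With_of`:
  Lemma 3 (2.38) DISPLAYED on `H` IS the socket's `h238` (definitional).
* §2 the M1 composition lemma in `DifferentiableOn ℂ` currency: a one-step output complex-differentiable on a set of
  the (Op × Hist)-space (NE5's `StepModel.OutputEnvelope`), composed with a COMPLEX BACKGROUND FAMILY complex-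
  differentiable from the (4.4)-ball of [I] p. 281 into that set (the substrate's `ComplexBackgroundFamily.uC` shape,
  ne9-leaf-04 g43 (F1)), is complex-differentiable on the (4.4)-ball — the shape of D4's leaf `hdiff`.  No
  `AnalyticOnNhd` anywhere (design point M1′: Mathlib has no Banach-domain `DifferentiableOn → AnalyticOnNhd`; the
  row's holomorphic-currency chain `B12Decay510Holo`/`RemainderLimitTorusHolo`/`RemainderLocalityHolo`/
  `RemainderDecay190HoloChain` consumes `DifferentiableOn` end to end).
* §3 `toPolLeavesTFac190H` — GIVEN a family of step objects over an exhausting torus sequence with Lemma 3 on `H`,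
  the holomorphic-currency socket `RemainderLocalityHolo.PolLeavesTFac190H` is inhabited from EXACTLY the remaining data: the background-direction analytic structure
  (`Wn, emb, hemb, hdiff`), the (190)-side data `Data190`, and the (1.7)-factorization / test-vector-limit data.  This is
  the field-count reduction promised in D4-CRUX-SOCKETS §4 (O-1): the crux supplies `StepObjectD4` + (2.38); the rest is
  the D4 adapter's own list, displayed here as arguments.
* §4 CAPSTONE `remainderConst_of_leafLists`: leaf lists per (scale, history) + the (1.22) read-out ⟹ the row-D4 END
  `RemainderConst S γ (ε₁ · K_rem,L)` (`ChainTFac190H.abs_beta1_le`).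
0 sorry.  [cite: Balaban1988RG2Cluster, (2.9)/(2.13) p.14, p.15, (2.38) p.20; Balaban1987RG1, (4.4) p.281, (1.7) p.261]
-/

noncomputable section

open Metric Filter Topology Set

namespace Literature.MathematicalPhysics.QuantumFieldTheory.Balaban1983to89.Beta.RemainderStepAdapterHolo

open Literature.MathematicalPhysics.QuantumFieldTheory.Balaban1983to89
open Literature.MathematicalPhysics.QuantumFieldTheory.Balaban1983to89.B13Resummation (SpRestr Repr213 locE)
open Literature.MathematicalPhysics.QuantumFieldTheory.Balaban1983to89.TreeLengthTorus (TPt TDom proj tsys)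
open Literature.MathematicalPhysics.QuantumFieldTheory.Balaban1983to89.TreeLengthTorusGeometry (TorusStep TTouch)
open Literature.MathematicalPhysics.QuantumFieldTheory.Balaban1983to89.B13ScaleTransfer (Pt)
open Literature.MathematicalPhysics.QuantumFieldTheory.Balaban1983to89.B12Decay510 (mixedDeriv)
open Literature.MathematicalPhysics.QuantumFieldTheory.Balaban1983to89.Beta.RemainderLimitTorus
open Literature.MathematicalPhysics.QuantumFieldTheory.Balaban1983to89.Beta.RemainderLocality
open Literature.MathematicalPhysics.QuantumFieldTheory.Balaban1983to89.Beta.RemainderDecay190 (Consts190 Data190)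
open Literature.MathematicalPhysics.QuantumFieldTheory.Balaban1983to89.Beta.RemainderLocalityHolo
open Literature.MathematicalPhysics.QuantumFieldTheory.Balaban1983to89.Beta.RemainderDecay190HoloChain
open Literature.MathematicalPhysics.QuantumFieldTheory.Balaban1983to89.Beta.RemainderChain (RemainderConst)
open Literature.MathematicalPhysics.QuantumFieldTheory.Balaban1983to89.Beta.RemainderChainLattice (CondsL SignsL remCoeffL)
open Literature.MathematicalPhysics.QuantumFieldTheory.Balaban1983to89.Beta.RemainderSeamHolo (hdiff_of_activities)

variable {d : ℕ}

/-! ## §1 The minimal step object D4 reads, and its `TorusStep` adapter -/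

/-- **The minimal one-step object row D4 reads** on the torus with `N` cubes per direction: configurations `Φ`
((𝐔, 𝐉) of the current fine torus), the analyticity domains `sp2 X` (𝔘ᶜ_{k+1}(X, α₀, α₁), [II] p. 15), the RESUMMED
activities `H Z` ((2.9)/(2.37)), and the restriction property of the spaces ([II] p. 15 *"we can restrict them, as
analytic functions, to the above subspace"*).  A DATA structure; no estimate inside.
[cite: Balaban1988RG2Cluster, (2.9) p.14 and p.15] -/
structure StepObjectD4 (d N : ℕ) [NeZero N] where
  Φ : Type
  sp2 : (tsys d N).Dom → Set Φ
  H : (tsys d N).Dom → Φ → ℂ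
  hsp : ∀ X Z : (tsys d N).Dom, ∀ φ, Z.1 ⊆ X.1 → φ ∈ sp2 X → φ ∈ sp2 Z

namespace StepObjectD4

variable {N : ℕ} [NeZero N] (O : StepObjectD4 d N)

open Classical in
/-- **(2.13) AS A DEFINITION**: `E^{(k+1)}(X, φ) := locE(H(·, φ))(X)`, the X-localized part of log Ξ of the polymer gas
on the torus with the incompatibility (2.11) and activities Z ↦ H(Z, φ) (Kotecký–Preiss form).
[cite: Balaban1988RG2Cluster, (2.13) p.14] -/
def E (X : (tsys d N).Dom) (φ : O.Φ) : ℂ :=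
  locE (TTouch (d := d) (N := N)) (fun Z : (tsys d N).Dom => Z.1) (fun Z => O.H Z φ) X.1

/-- **The `TorusStep` adapter.**  The Lemma 1–2 fields (`Dk, volk, sp1, Bond, Bv, Vp, V, Q, Vpp, Elog`) and the
abstract predicates (`Analytic, GaugeInv, Repr17, Restr`) are NOT read by row D4's socket `PolLeavesTFac190` and are
filled with inert values; `Φ, sp2, H` are the object's, `Ek1 := E` by (2.13).  NOT an inhabitant for `Deliverables`.
[folklore] -/
def toTorusStep : TorusStep d N where
  Dk := tsys d N
  volk := fun _ => 0
  Φ := O.Φ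
  Bond := Unit
  sp1 := fun _ => Set.univ
  sp2 := O.sp2
  Bv := fun _ _ => 0
  Vp := fun _ _ => 0
  V := fun _ _ => 0
  Q := fun _ _ _ _ => 0
  Vpp := fun _ _ => 0
  H := O.H
  Ek1 := O.E
  Elog := fun _ _ => 0
  Analytic := fun _ _ => True
  GaugeInv := fun _ => True
  Repr17 := True
  Restr := True

/-- The adapter's configurations are the object's. [folklore] -/
@[simp] private theorem toTorusStep_Φ : O.toTorusStep.Φ = O.Φ := rfl

/-- The adapter's spaces are the object's. [folklore] -/
@[simp] private theorem toTorusStep_sp2 : O.toTorusStep.sp2 = O.sp2 := rfl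

/-- The adapter's activities are the object's. [folklore] -/
@[simp] private theorem toTorusStep_H : O.toTorusStep.H = O.H := rfl

/-- The adapter's E^{(k+1)} is (2.13) of the object's activities. [folklore] -/
@[simp] private theorem toTorusStep_Ek1 : O.toTorusStep.Ek1 = O.E := rfl

/-- The restriction property (p. 15) of the adapter, from the object's `hsp`. [cite: Balaban1988RG2Cluster, p.15] -/
theorem spRestr : SpRestr O.toTorusStep.toStepData O.toTorusStep.geom :=
  TorusStep.spRestr _ O.hsp

open Classical in
/-- The representation (2.13) holds for the adapter BY CONSTRUCTION. [cite: Balaban1988RG2Cluster, (2.13) p.14] -/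
theorem repr213 : Repr213 O.toTorusStep.toStepData O.toTorusStep.geom :=
  TorusStep.repr213 _ fun _ _ _ => rfl

/-- **Lemma 3 (2.38)_ℓ DISPLAYED on the object's activities**: `‖H(Z, φ)‖ ≤ C₃ε₁ exp(−(1 − 8δ)ℓκ d_{k+1}(Z))` on
`sp2 Z`, with d_{k+1} = the torus tree length.  A hypothesis shape (what the shared crux's (D2)/(R-1) delivers, in
|·|-form). [cite: Balaban1988RG2Cluster, (2.38) p.20] -/
def Lemma3OnH (c : B13.Consts) (ℓ : ℝ) : Prop :=
  ∀ Z φ, φ ∈ O.sp2 Z → ‖O.H Z φ‖ ≤ c.C3act * c.ε₁ * Real.exp (-((1 - 8 * c.δ) * ℓ * c.κ * (tsys d N).dj Z))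

/-- (2.38) displayed on `H` IS the socket's leaf `h238 : B13.Bound238With` for the adapter (definitional).
[cite: Balaban1988RG2Cluster, (2.38) p.20] -/
theorem bound238With_of {c : B13.Consts} {ℓ : ℝ} (h : O.Lemma3OnH c ℓ) :
    B13.Bound238With O.toTorusStep.toStepData c ℓ :=
  fun Z φ hφ => h Z φ hφ

/-- Conversely the socket's leaf is nothing but (2.38) on `H`. [cite: Balaban1988RG2Cluster, (2.38) p.20] -/
theorem bound238With_iff {c : B13.Consts} {ℓ : ℝ} :
    B13.Bound238With O.toTorusStep.toStepData c ℓ ↔ O.Lemma3OnH c ℓ :=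
  Iff.rfl

end StepObjectD4

/-! ## §2 M1: background-direction holomorphy by composition — `DifferentiableOn` currency -/

section Composition

variable {Wn Op Hist : Type*} [NormedAddCommGroup Wn] [NormedSpace ℂ Wn] [NormedAddCommGroup Op]
  [NormedSpace ℂ Op] [NormedAddCommGroup Hist] [NormedSpace ℂ Hist]

/-- **M1 by composition, holomorphic currency.**  IF a one-step output `Out : Op × Hist → ℂ` is complex-differentiable on
a set `U` of the complex (operator × history)-space (NE5's `StepModel.OutputEnvelope` records exactly this on the
two-margin box — located gap G-ne5p1-1′, not inhabited by the instance of record), and the COMPLEX BACKGROUND FAMILY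
`data : Wn → Op × Hist` (the substrate's `ComplexBackgroundFamily.uC`-type map — [B9] Thm 3.4 / [I] Lemma 4, NE9's (D1)
object; `DifferentiableOn ℂ` on a Banach ball BY SIGNATURE) is complex-differentiable on the (4.4)-ball `‖𝐀‖ < α₂` and
maps it into `U`, THEN 𝐀 ↦ Out(data 𝐀) is complex-differentiable on the (4.4)-ball — the shape of row D4's leaf `hdiff`
(`PolLeavesTFac190H`).  Mathlib `DifferentiableOn.comp`; no analyticity anywhere. [cite: Balaban1987RG1, (4.4) p.281] -/
theorem differentiableOn_background_of_comp {Out : Op × Hist → ℂ} {U : Set (Op × Hist)}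
    (hOut : DifferentiableOn ℂ Out U) {data : Wn → Op × Hist} {α₂ : ℝ}
    (hdata : DifferentiableOn ℂ data (ball 0 α₂)) (hmaps : MapsTo data (ball 0 α₂) U) :
    DifferentiableOn ℂ (fun v => Out (data v)) (ball 0 α₂) :=
  hOut.comp hdata hmaps

/-- The same with the two data components given separately (operators `op 𝐀`, inserted history `ins 𝐀`).
[cite: Balaban1987RG1, (4.4) p.281] -/
theorem differentiableOn_background_of_comp₂ {Out : Op × Hist → ℂ} {U : Set (Op × Hist)}
    (hOut : DifferentiableOn ℂ Out U) {op : Wn → Op} {ins : Wn → Hist} {α₂ : ℝ}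
    (hop : DifferentiableOn ℂ op (ball 0 α₂)) (hins : DifferentiableOn ℂ ins (ball 0 α₂))
    (hmaps : ∀ v ∈ ball (0 : Wn) α₂, (op v, ins v) ∈ U) :
    DifferentiableOn ℂ (fun v => Out (op v, ins v)) (ball 0 α₂) :=
  hOut.comp (hop.prodMk hins) fun v hv => hmaps v hv

end Composition

/-! ## §3 The socket from step objects + (2.38) + the D4 adapter's own data -/

section Socket

variable {M : ℕ} [NeZero M]

/-- **`PolLeavesTFac190H` (holomorphic currency) FROM a family of step objects with Lemma 3 on `H`** over an exhausting torus sequence, plus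
EXACTLY the D4 adapter's own data: the background-direction analytic structure (`Wn`, `emb`, `hemb`, `hdiff` — [I] §4, complex Fréchet differentiability),
the (190)-side data `D : Data190` ([15]/B11), and the (1.7)-factorization / test-vector-limit data (`V, F, hF, r, hfac,
t, hconv`, with `hFd : ∀ Y, ∃ ρ > 0, DifferentiableOn ℂ (F Y) (ball 0 ρ)`) with the read-out `a`.  The O.3/O.4/A fields are discharged by §1; `EXn`, `hcomp`, `E2n`, `hrepr` by
construction. [cite: Balaban1987RG1, (1.7) p.261, (1.21) p.264, (4.4) p.281, (4.35) p.290; Balaban1988RG2Cluster, (2.38) p.20] -/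
def toPolLeavesTFac190H (N : ℕ → ℕ) [hN : ∀ n, NeZero (N n)] (hNlim : Tendsto N atTop atTop)
    (O : (n : ℕ) → StepObjectD4 d (N n)) (c : B13.Consts) (ℓ α₂ : ℝ) (q : Consts190)
    (h3 : ∀ n, (O n).Lemma3OnH c ℓ)
    (Wn : ℕ → Type) [instW : ∀ n, NormedAddCommGroup (Wn n)] [instWs : ∀ n, NormedSpace ℂ (Wn n)]
    (emb : (n : ℕ) → TDom d (N n) → Wn n → (O n).Φ)
    (hemb : ∀ n X, ∀ v ∈ ball (0 : Wn n) α₂, emb n X v ∈ (O n).sp2 X)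
    (hdiff : ∀ n X, DifferentiableOn ℂ (fun v => (O n).E X (emb n X v)) (ball 0 α₂))
    (D : Data190 d M N Wn q)
    (V : LDom d → Type) [instV : ∀ Y, NormedAddCommGroup (V Y)] [instVs : ∀ Y, NormedSpace ℂ (V Y)]
    (F : (Y : LDom d) → V Y → ℂ) (hFd : ∀ Y, ∃ ρ > 0, DifferentiableOn ℂ (F Y) (ball 0 ρ))
    (r : (n : ℕ) → (Y : LDom d) → Wn n →L[ℂ] V Y)
    (hfac : ∀ Y : LDom d, ∀ᶠ n in atTop, ∀ v ∈ ball (0 : Wn n) α₂,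
      (O n).E (tproj (N n) Y) (emb n (tproj (N n) Y) v) = F Y (r n Y v))
    (t : (Y : LDom d) → Pt d → V Y)
    (hconv : ∀ (Y : LDom d) (x : Pt d),
      Tendsto (fun n => r n Y (D.hn n (tproj (N n) Y) (proj (N n * M) x))) atTop (𝓝 (t Y x)))
    (a : LDom d → Pt d → ℝ) (ha : ∀ (Y : LDom d) (z : Pt d), a Y z = (mixedDeriv (F Y) (t Y 0) (t Y z)).re) :
    PolLeavesTFac190H d M a c ℓ α₂ q where
  N := N
  hN := hN
  hNlim := hNlim
  W := fun n => (O n).toTorusStep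
  hsp := fun n => (O n).spRestr
  hrep := fun n => (O n).repr213
  h238 := fun n => (O n).bound238With_of (h3 n)
  Wn := Wn
  instW := instW
  instWs := instWs
  EXn := fun n X v => (O n).E X (emb n X v)
  emb := emb
  hemb := hemb
  hcomp := fun _ _ _ => rfl
  D := D
  E2n := fun n X x y => (mixedDeriv (fun v => (O n).E X (emb n X v)) (D.hn n X x) (D.hn n X y)).re
  hdiff := hdiff
  hrepr := fun _ _ _ _ => rfl
  V := V
  instV := instV
  instVs := instVs
  F := F
  hFd := hFd
  r := r
  hfac := hfac
  t := t
  hconv := hconv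
  ha := ha

end Socket

/-! ## §3′ (v3) The socket from step objects + (2.38) + the H-LAYER holomorphy datum -/

section SocketH

variable {M : ℕ} [NeZero M]

/-- **The E-layer leaf `hdiff` of one step object FROM ITS ACTIVITIES** (road P3's seam lemma, by name): under
`CondsL d c ℓ` and `0 ≤ C₃ε₁`, Lemma 3 (2.38) on `H` and complex-differentiability of the activities `v ↦ H(Z, emb v)` of
the polymers `Z ⊂ X` along a seam into `sp2 X` give complex-differentiability of `v ↦ E(X, emb v)` ((2.13) AS DEFINED in
§1) on the α₂-ball.  [II] p. 15 *"the activities in (2.13), and the whole sum E^{(k+1)}(X), are analytic functions of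
(𝐔, 𝐉), on the space 𝐔ᶜ_{k+1}(X, α₀, α₁)"*. [cite: Balaban1988RG2Cluster, p.15 and p.20 (after (2.38)); Balaban1987RG1, (4.4) p.281] -/
theorem StepObjectD4.differentiableOn_E_of_activities {N : ℕ} [NeZero N] (O : StepObjectD4 d N) {c : B13.Consts}
    {ℓ : ℝ} (h3 : O.Lemma3OnH c ℓ) (hC : CondsL d c ℓ) (hA : 0 ≤ c.C3act * c.ε₁)
    {Wn : Type*} [NormedAddCommGroup Wn] [NormedSpace ℂ Wn] (X : TDom d N) (emb : Wn → O.Φ) {α₂ : ℝ}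
    (hemb : ∀ v ∈ ball (0 : Wn) α₂, emb v ∈ O.sp2 X)
    (hH : ∀ Z : TDom d N, Z.1 ⊆ X.1 → DifferentiableOn ℂ (fun v => O.H Z (emb v)) (ball 0 α₂)) :
    DifferentiableOn ℂ (fun v => O.E X (emb v)) (ball 0 α₂) :=
  hdiff_of_activities O.toTorusStep O.spRestr O.repr213 (O.bound238With_of h3) hC hA X emb
    (fun v => O.E X (emb v)) hemb (fun _ => rfl) hH

/-- **`PolLeavesTFac190H` FROM step objects + (2.38) + the H-LAYER datum** (v3 form of `toPolLeavesTFac190H`): the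
same argument list with the E-layer leaf `hdiff` REPLACED by `hH : ∀ n X Z, Z ⊂ X → DifferentiableOn ℂ
(v ↦ H_n(Z, emb n X v)) (ball 0 α₂)` on the resummed activities, at the price of `CondsL d c ℓ` and `0 ≤ C₃ε₁` (both
consumed by the END anyway).  This is the currency the shared crux's object builders produce (activities holomorphic on
𝐔ᶜ_{k+1}(X, α₀, α₁), [II] p. 15), read along the (4.4)-seam of [I] p. 281.
[cite: Balaban1987RG1, (1.7) p.261, (1.21) p.264, (4.4) p.281, (4.35) p.290; Balaban1988RG2Cluster, p.15 and (2.38) p.20] -/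
def toPolLeavesTFac190H_ofActivities (N : ℕ → ℕ) [hN : ∀ n, NeZero (N n)] (hNlim : Tendsto N atTop atTop)
    (O : (n : ℕ) → StepObjectD4 d (N n)) (c : B13.Consts) (ℓ α₂ : ℝ) (q : Consts190)
    (h3 : ∀ n, (O n).Lemma3OnH c ℓ) (hC : CondsL d c ℓ) (hA : 0 ≤ c.C3act * c.ε₁)
    (Wn : ℕ → Type) [instW : ∀ n, NormedAddCommGroup (Wn n)] [instWs : ∀ n, NormedSpace ℂ (Wn n)]
    (emb : (n : ℕ) → TDom d (N n) → Wn n → (O n).Φ)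
    (hemb : ∀ n X, ∀ v ∈ ball (0 : Wn n) α₂, emb n X v ∈ (O n).sp2 X)
    (hH : ∀ n (X Z : TDom d (N n)), Z.1 ⊆ X.1 →
      DifferentiableOn ℂ (fun v => (O n).H Z (emb n X v)) (ball 0 α₂))
    (D : Data190 d M N Wn q)
    (V : LDom d → Type) [instV : ∀ Y, NormedAddCommGroup (V Y)] [instVs : ∀ Y, NormedSpace ℂ (V Y)]
    (F : (Y : LDom d) → V Y → ℂ) (hFd : ∀ Y, ∃ ρ > 0, DifferentiableOn ℂ (F Y) (ball 0 ρ))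
    (r : (n : ℕ) → (Y : LDom d) → Wn n →L[ℂ] V Y)
    (hfac : ∀ Y : LDom d, ∀ᶠ n in atTop, ∀ v ∈ ball (0 : Wn n) α₂,
      (O n).E (tproj (N n) Y) (emb n (tproj (N n) Y) v) = F Y (r n Y v))
    (t : (Y : LDom d) → Pt d → V Y)
    (hconv : ∀ (Y : LDom d) (x : Pt d),
      Tendsto (fun n => r n Y (D.hn n (tproj (N n) Y) (proj (N n * M) x))) atTop (𝓝 (t Y x)))
    (a : LDom d → Pt d → ℝ) (ha : ∀ (Y : LDom d) (z : Pt d), a Y z = (mixedDeriv (F Y) (t Y 0) (t Y z)).re) :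
    PolLeavesTFac190H d M a c ℓ α₂ q :=
  toPolLeavesTFac190H N hNlim O c ℓ α₂ q h3 Wn emb hemb
    (fun n X => (O n).differentiableOn_E_of_activities (h3 n) hC hA X (emb n X) (hemb n X) (hH n X))
    D V F hFd r hfac t hconv a ha

end SocketH

/-! ## §4 CAPSTONE: from step objects per (scale, history) to the row-D4 END -/

section Capstone

variable {M : ℕ} [NeZero M]

/-- **HOW (D4) CLOSES, in one statement.**  For the β-family `β` with one-loop split `S` on the boxes `]0,γ]^{k+1}`:
IF for every scale `k` and history `p` in the box one has a holomorphic-currency leaf list `L k p` (e.g. built by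
`toPolLeavesTFac190H` from the shared crux's step objects over an exhausting torus family + (2.38) on H + the adapter's
own data) whose infinite-volume kernel `A1 k p` reads out β¹ by (1.22) (`beta1_eq` — the identification binder this row
shares with row D1's `hβ`), THEN `|β¹_{k+1}(g_0,…,g_k)| ≤ ε₁ · K_rem,L(4, M, c, α₂, Cκ̄_Bcm)` for every k and every
history (`ChainTFac190H.abs_beta1_le`), under the numeric side conditions N1–N3 (`CondsL`, `R22gen`, `Valid`,
`SignsL`).  Nothing of Bałaban's is asserted: the hypotheses ARE the shared crux + the adapter data.
[cite: Balaban1987RG1, (1.22) p.264 and (5.10) p.293; Balaban1988RG2Cluster, (2.38) p.20; Balaban1985Variational, (190) p.308] -/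
theorem remainderConst_of_leafLists {d : ℕ} {μ ν : Fin d} {β : FlowStep.HBeta} (S : B12Beta.OneLoopSplit β) {γ : ℝ}
    {c : B13.Consts} {ℓ α₂ : ℝ} {q : Consts190}
    (A1 : (k : ℕ) → (Fin (k + 1) → ℝ) → LDom d → Pt d → ℝ)
    (beta1_eq : ∀ k p, p ∈ B12Beta.HistBox γ k →
      S.β1 k p = B12Beta.secondMoment (fun _ _ => limKernel (A1 k p)) μ ν)
    (L : ∀ k p, p ∈ B12Beta.HistBox γ k → PolLeavesTFac190H d M (A1 k p) c ℓ α₂ q)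
    (hC : CondsL d c ℓ) (h22 : c.R22gen ℓ) (hq : q.Valid c.δ₀) (hs : SignsL c α₂ q.B₃) :
    RemainderConst S γ (c.ε₁ * remCoeffL d M c α₂ q.B₃) :=
  (ChainTFac190H.mk (S := S) A1 beta1_eq L).abs_beta1_le hC h22 hq hs (Fin.pos μ)

/-- **HOW (D4) CLOSES FROM THE H-LAYER, in one statement** (v3): as `remainderConst_of_leafLists`, each leaf list being
built by `toPolLeavesTFac190H_ofActivities` from, per (scale, history): step objects over an exhausting torus family,
(2.38) on their activities, seams into the analyticity domains with the ACTIVITIES complex-differentiable along them, the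
(190)-side data and the (1.7)-factorization ∕ test-vector data; plus the (1.22) read-out `beta1_eq` and N1–N3.  Displayed
so that a crux object builder sees the complete list of what row D4 consumes; nothing of Bałaban's is asserted.
[cite: Balaban1987RG1, (1.22) p.264, (4.4) p.281 and (5.10) p.293; Balaban1988RG2Cluster, p.15 and (2.38) p.20; Balaban1985Variational, (190) p.308] -/
theorem remainderConst_of_stepLeafLists {d : ℕ} {μ ν : Fin d} {β : FlowStep.HBeta} (S : B12Beta.OneLoopSplit β)
    {γ : ℝ} {c : B13.Consts} {ℓ α₂ : ℝ} {q : Consts190}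
    (hC : CondsL d c ℓ) (h22 : c.R22gen ℓ) (hq : q.Valid c.δ₀) (hs : SignsL c α₂ q.B₃) (hA : 0 ≤ c.C3act * c.ε₁)
    (A1 : (k : ℕ) → (Fin (k + 1) → ℝ) → LDom d → Pt d → ℝ)
    (beta1_eq : ∀ k p, p ∈ B12Beta.HistBox γ k →
      S.β1 k p = B12Beta.secondMoment (fun _ _ => limKernel (A1 k p)) μ ν)
    -- per (scale, history): the torus family, the step objects, (2.38), the seams, the H-layer datum, the rest
    (N : (k : ℕ) → (Fin (k + 1) → ℝ) → ℕ → ℕ) (hN : ∀ k p n, NeZero (N k p n))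
    (hNlim : ∀ k p, Tendsto (N k p) atTop atTop)
    (O : (k : ℕ) → (p : Fin (k + 1) → ℝ) → (n : ℕ) → StepObjectD4 d (N k p n))
    (h3 : ∀ k p n, (O k p n).Lemma3OnH c ℓ)
    (Wn : (k : ℕ) → (Fin (k + 1) → ℝ) → ℕ → Type) (instW : ∀ k p n, NormedAddCommGroup (Wn k p n))
    (instWs : ∀ k p n, NormedSpace ℂ (Wn k p n))
    (emb : (k : ℕ) → (p : Fin (k + 1) → ℝ) → (n : ℕ) → TDom d (N k p n) → Wn k p n → (O k p n).Φ)
    (hemb : ∀ k p n X, ∀ v ∈ ball (0 : Wn k p n) α₂, emb k p n X v ∈ (O k p n).sp2 X)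
    (hH : ∀ k p n (X Z : TDom d (N k p n)), Z.1 ⊆ X.1 →
      DifferentiableOn ℂ (fun v => (O k p n).H Z (emb k p n X v)) (ball 0 α₂))
    (D : (k : ℕ) → (p : Fin (k + 1) → ℝ) → Data190 d M (N k p) (Wn k p) q)
    (V : (k : ℕ) → (Fin (k + 1) → ℝ) → LDom d → Type) (instV : ∀ k p Y, NormedAddCommGroup (V k p Y))
    (instVs : ∀ k p Y, NormedSpace ℂ (V k p Y))
    (F : (k : ℕ) → (p : Fin (k + 1) → ℝ) → (Y : LDom d) → V k p Y → ℂ)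
    (hFd : ∀ k p Y, ∃ ρ > 0, DifferentiableOn ℂ (F k p Y) (ball 0 ρ))
    (r : (k : ℕ) → (p : Fin (k + 1) → ℝ) → (n : ℕ) → (Y : LDom d) → Wn k p n →L[ℂ] V k p Y)
    (hfac : ∀ k p (Y : LDom d), ∀ᶠ n in atTop, ∀ v ∈ ball (0 : Wn k p n) α₂,
      (O k p n).E (tproj (N k p n) Y) (emb k p n (tproj (N k p n) Y) v) = F k p Y (r k p n Y v))
    (t : (k : ℕ) → (p : Fin (k + 1) → ℝ) → (Y : LDom d) → Pt d → V k p Y)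
    (hconv : ∀ k p (Y : LDom d) (x : Pt d),
      Tendsto (fun n => r k p n Y ((D k p).hn n (tproj (N k p n) Y) (proj (N k p n * M) x))) atTop
        (𝓝 (t k p Y x)))
    (ha : ∀ k p (Y : LDom d) (z : Pt d), A1 k p Y z = (mixedDeriv (F k p Y) (t k p Y 0) (t k p Y z)).re) :
    RemainderConst S γ (c.ε₁ * remCoeffL d M c α₂ q.B₃) :=
  remainderConst_of_leafLists S A1 beta1_eq
    (fun k p _ => toPolLeavesTFac190H_ofActivities (hN := hN k p) (N k p) (hNlim k p) (O k p) c ℓ α₂ q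
      (h3 k p) hC hA (Wn k p) (instW := instW k p) (instWs := instWs k p) (emb k p) (hemb k p) (hH k p)
      (D k p) (V k p) (instV := instV k p) (instVs := instVs k p) (F k p) (hFd k p) (r k p) (hfac k p)
      (t k p) (hconv k p) (A1 k p) (ha k p))
    hC h22 hq hs

end Capstone

end Literature.MathematicalPhysics.QuantumFieldTheory.Balaban1983to89.Beta.RemainderStepAdapterHolo

end
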